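import Mathlib.LinearAlgebra.Lagrange
import Literature.AlgebraicGeometry.Motives.MumfordTateInvariantsStable
import HarnessLib

/-!
# `MT(ℚ)`-stable subspaces of `T^{a,b}` are sub-Hodge structures (Mumford–Tate invariants, step 12)

Continuation of `MumfordTateInvariantsStable.lean`: for a pure `ℚ`-Hodge structure `H` on a
finite-dimensional `V` and a rational subspace `W ⊆ T^{a,b}` stable under the rational points
`MT(H)(ℚ) = H.mumfordTateGroup`,

* `tensorDerivation_apply_mem_of_mumfordTateGroup_stable`: `W` is stable under the Lie algebra
  `𝔰 = lieStabilizer H` — the nilpotent directions through the unipotents `exp N ∈ MT(ℚ)`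
  (`tensorDerivation_apply_mem_of_stable`), the semisimple directions through the rational torus
  elements of `exists_torusElement`, chosen to SEPARATE the eigenspaces of `ρ(S_ℂ)` on `T^{a,b}_ℂ`
  (so that a subspace stable under the torus element decomposes along them);
* `subspaceBaseChange_gradingEnd_stable_of_mumfordTateGroup_stable`: consequently `W_ℂ` is stable
  under the Hodge grading operator `ρ(Θ)`, i.e. `W` is a sub-Hodge structure of `T^{a,b}`
  (Green–Griffiths–Kerr, *Mumford–Tate groups and domains*, (I.B.5): "`W ⊂ T^{k,l}` is a sub-Hodge
  structure iff `M(W) ⊆ W`"; Deligne, LNM 900, I, proof of 3.4/3.6), read on `ℚ`-points.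

This is the input for the complete reducibility statement (ii) of
`Deligne1982_mumfordTateInvariants` (the complement is then `W^⊥` for a polarization, GGK (I.B.6)).

## References

* M. Green, P. Griffiths, M. Kerr, *Mumford–Tate groups and domains* (2012), (I.B.5), (I.B.6).
* P. Deligne, *Hodge cycles on abelian varieties*, LNM 900 (1982), I §3.
-/

noncomputable section

open scoped TensorProduct
open Polynomial

namespace Literature.AlgebraicGeometry.Motives

namespace HodgeStructure

universe u v

variable {V : Type u} [AddCommGroup V] [Module ℚ V] [Module.Finite ℚ V] [HodgeTensorFacts.{u, u}]
  {n : ℤ}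

omit [HodgeTensorFacts.{u, u}] in
/-- The complexification of an `g`-stable rational subspace is stable under `g_ℂ`. [folklore] -/
theorem subspaceBaseChange_tensorSpaceActOver_stable {a b : ℕ} (W : Submodule ℚ (hodgeTensorSpace V a b))
    {g : V ≃ₗ[ℚ] V} (hg : ∀ w ∈ W, tensorSpaceAct g w ∈ W)
    {s : hodgeTensorSpaceOver ℂ (ℂ ⊗[ℚ] V) a b} (hs : s ∈ subspaceBaseChange V W) :
    tensorSpaceActOver (g.baseChange ℚ ℂ V V) s ∈ subspaceBaseChange V W := by
  rw [subspaceBaseChange_eq_span] at hs ⊢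
  induction hs using Submodule.span_induction with
  | mem x hx =>
    obtain ⟨w, hw, rfl⟩ := hx
    rw [← tensorSpaceToBaseChange_tensorSpaceAct]
    exact Submodule.subset_span ⟨_, hg w hw, rfl⟩
  | zero => simp
  | add x y _ _ hx hy =>
    rw [map_add]
    exact Submodule.add_mem _ hx hy
  | smul c x _ hx =>
    rw [map_smul]
    exact Submodule.smul_mem _ c hx

/-- **Semisimple directions**: if `W ⊆ T^{a,b}` is `MT(H)(ℚ)`-stable and `S ∈ 𝔰` is semisimple,
then `ρ(S) W ⊆ W`. Choose (by `exists_torusElement`) a rational torus element `g ∈ MT(ℚ)` through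
`S` whose eigenvalues on the tensor basis separate the eigenvalues of `ρ(S_ℂ)`; then `ρ(S_ℂ)` is
a polynomial in `g_ℂ` (Lagrange interpolation on the eigenvalues) and `W_ℂ`, being `g_ℂ`-stable,
is `ρ(S_ℂ)`-stable. [folklore] -/
theorem tensorDerivation_apply_mem_of_stable_semisimple (H : HodgeStructure V n) {a b : ℕ}
    (W : Submodule ℚ (hodgeTensorSpace V a b))
    (hW : ∀ g ∈ H.mumfordTateGroup, ∀ w ∈ W, tensorSpaceAct g w ∈ W) {S : Module.End ℚ V}
    (hSmem : S ∈ H.lieStabilizer) (hSss : S.IsSemisimple) {w : hodgeTensorSpace V a b} (hw : w ∈ W) :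
    tensorDerivation a b S w ∈ W := by
  classical
  obtain ⟨ι, _, bb, ev, hbb⟩ := exists_eigenbasis_of_isSemisimple hSss
  -- eigenvalues of `ρ(S_ℂ)` on the tensor basis
  let κ : (Fin a → ι) × (Fin b → ι) → ℂ := fun x => ∑ μ, tensorWeight ev x μ • (μ : ℂ)
  have hdiagS : ∀ x : (Fin a → ι) × (Fin b → ι),
      tensorDerivation a b (S.baseChange ℂ) (hodgeTensorBasis bb a b x) =
        κ x • hodgeTensorBasis bb a b x := fun x => by
    rw [tensorDerivation_hodgeTensorBasis' bb hbb x,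
      tensorDerivation_eigenvalue_eq_sum_tensorWeight ev (fun μ => (μ : ℂ)) x]
  -- the weight differences of pairs of indices with different eigenvalues
  let 𝓜 : Finset ((minpoly ℚ S).rootSet ℂ → ℤ) :=
    ((Finset.univ ×ˢ Finset.univ).filter fun p : ((Fin a → ι) × (Fin b → ι)) ×
      ((Fin a → ι) × (Fin b → ι)) => κ p.1 ≠ κ p.2).image
        fun p => tensorWeight ev p.1 - tensorWeight ev p.2
  have h𝓜 : ∀ M ∈ 𝓜, ∑ μ : (minpoly ℚ S).rootSet ℂ, M μ • (μ : ℂ) ≠ 0 := by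
    intro M hM
    obtain ⟨p, hp, rfl⟩ := Finset.mem_image.1 hM
    have hne := (Finset.mem_filter.1 hp).2
    simp only [Pi.sub_apply, sub_smul, Finset.sum_sub_distrib]
    exact sub_ne_zero.2 hne
  obtain ⟨g, U, hgMT, hgb, hU0, -, hsep⟩ := exists_torusElement H hSmem hSss bb ev hbb 𝓜 h𝓜
  -- eigenvalues of `g_ℂ` on the tensor basis
  let c : (Fin a → ι) × (Fin b → ι) → ℂ := fun x => ∏ μ, U μ ^ tensorWeight ev x μ
  have hgb' : ∀ i, (g.baseChange ℚ ℂ V V) (bb i) = U (ev i) • bb i := fun i => by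
    change (g : V →ₗ[ℚ] V).baseChange ℂ (bb i) = _
    exact hgb i
  obtain ⟨G, hG_def⟩ :
      ∃ G, G = (tensorSpaceActOver (a := a) (b := b) (g.baseChange ℚ ℂ V V)).toLinearMap := ⟨_, rfl⟩
  have hdiagG : ∀ x : (Fin a → ι) × (Fin b → ι),
      G (hodgeTensorBasis bb a b x) = c x • hodgeTensorBasis bb a b x := fun x => by
    rw [hG_def, tensorSpaceActOver_hodgeTensorBasis' bb hgb' x]
    exact congrArg (· • hodgeTensorBasis bb a b x) (prod_zpow_tensorWeight ev x hU0).symm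
  -- separation: equal `g`-eigenvalues force equal `ρ(S)`-eigenvalues
  have hsepκ : ∀ x x', c x = c x' → κ x = κ x' := by
    intro x x' hcc
    by_contra hne
    have hmem : tensorWeight ev x - tensorWeight ev x' ∈ 𝓜 :=
      Finset.mem_image.2 ⟨(x, x'), Finset.mem_filter.2 ⟨by simp, hne⟩, rfl⟩
    apply hsep _ hmem
    have hcx' : c x' ≠ 0 := Finset.prod_ne_zero_iff.2 fun μ _ => zpow_ne_zero _ (hU0 μ)
    simp only [Pi.sub_apply, zpow_sub₀ (hU0 _), Finset.prod_div_distrib]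
    rw [div_eq_one_iff_eq hcx']
    exact hcc
  -- `W_ℂ` is `G`-stable, hence decomposes along the `G`-eigenspaces
  have hWG : ∀ s ∈ subspaceBaseChange V W, G s ∈ subspaceBaseChange V W := fun s hs => by
    rw [hG_def, LinearEquiv.coe_coe]
    exact subspaceBaseChange_tensorSpaceActOver_stable W (hW g hgMT) hs
  -- `ρ(S_ℂ)` is a polynomial in `G`: interpolate `c x ↦ κ x` (well defined by separation)
  let r : ℂ → ℂ := fun z => if h : ∃ x, c x = z then κ (Classical.choose h) else 0
  have hr : ∀ x, r (c x) = κ x := fun x => by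
    have h : ∃ x', c x' = c x := ⟨x, rfl⟩
    simp only [r, dif_pos h]
    exact hsepκ _ _ (Classical.choose_spec h)
  obtain ⟨Q, hQ⟩ : ∃ Q : ℂ[X], ∀ x, Q.eval (c x) = κ x := by
    refine ⟨Lagrange.interpolate (Finset.univ.image c) id r, fun x => ?_⟩
    rw [← hr x]
    exact Lagrange.eval_interpolate_at_node r Function.injective_id.injOn
      (Finset.mem_image_of_mem c (Finset.mem_univ x))
  have hDQ : tensorDerivation a b (S.baseChange ℂ) = aeval G Q := by
    refine (hodgeTensorBasis bb a b).ext fun x => ?_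
    have h := @Module.End.aeval_apply_of_mem_apply_eq_smul ℂ (hodgeTensorSpaceOver ℂ (ℂ ⊗[ℚ] V) a b)
      _ _ _ G (c x) (hodgeTensorBasis bb a b x) Q (hdiagG x)
    rw [hdiagS, h, hQ]
  -- `W_ℂ` is stable under polynomials in `G`
  have hpow : ∀ (i : ℕ) (s), s ∈ subspaceBaseChange V W → (G ^ i) s ∈ subspaceBaseChange V W := by
    intro i
    induction i with
    | zero =>
      intro s hs
      simpa using hs
    | succ i ih =>
      intro s hs
      rw [pow_succ', Module.End.mul_apply]
      exact hWG _ (ih s hs)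
  have key : ∀ s ∈ subspaceBaseChange V W,
      tensorDerivation a b (S.baseChange ℂ) s ∈ subspaceBaseChange V W := by
    intro s hs
    rw [hDQ, aeval_eq_sum_range, LinearMap.sum_apply]
    exact Submodule.sum_mem _ fun i _ => by
      rw [LinearMap.smul_apply]
      exact Submodule.smul_mem _ _ (hpow i s hs)
  exact tensorDerivation_mem_of_subspaceBaseChange V W key hw

/-- **An `MT(H)(ℚ)`-stable rational subspace of `T^{a,b}` is stable under the Lie algebra `𝔰`**
(Jordan decomposition in `𝔰`; the nilpotent part through `exp N ∈ MT(ℚ)`, the semisimple part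
through rational torus elements). [cite: GreenGriffithsKerr2012, I.B.5] -/
theorem tensorDerivation_apply_mem_of_mumfordTateGroup_stable (H : HodgeStructure V n) {a b : ℕ}
    (W : Submodule ℚ (hodgeTensorSpace V a b))
    (hW : ∀ g ∈ H.mumfordTateGroup, ∀ w ∈ W, tensorSpaceAct g w ∈ W) {X : Module.End ℚ V}
    (hX : X ∈ H.lieStabilizer) {w : hodgeTensorSpace V a b} (hw : w ∈ W) :
    tensorDerivation a b X w ∈ W := by
  obtain ⟨N, S, hNnil, hSss, hXNS, hNmem, hSmem⟩ := exists_jordan_mem_lieStabilizer H hX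
  rw [hXNS, map_add, LinearMap.add_apply]
  refine Submodule.add_mem _ ?_ (tensorDerivation_apply_mem_of_stable_semisimple H W hW hSmem hSss hw)
  exact tensorDerivation_apply_mem_of_stable hNnil W
    (hW _ (unipotentOfNilpotent_mem_mumfordTateGroup H hNmem hNnil)) hw

/-- **An `MT(H)(ℚ)`-stable rational subspace of `T^{a,b}` is a sub-Hodge structure**: its
complexification is stable under the Hodge grading operator `ρ(Θ)` of any graded basis adapted
to `H` (GGK (I.B.5), Deligne I 3.4, read on `ℚ`-points). [cite: GreenGriffithsKerr2012, I.B.5] -/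
theorem subspaceBaseChange_gradingEnd_stable_of_mumfordTateGroup_stable (H : HodgeStructure V n)
    {S : Type u} [Fintype S] [DecidableEq S] {deg : S → ℤ} (e : Module.Basis S ℂ (ℂ ⊗[ℚ] V))
    (hF : ∀ p, H.F p = Submodule.span ℂ (e '' {σ | p ≤ deg σ}))
    (hFc : ∀ p, complexConj (H.F p) = Submodule.span ℂ (e '' {σ | deg σ ≤ n - p})) {a b : ℕ}
    (W : Submodule ℚ (hodgeTensorSpace V a b))
    (hW : ∀ g ∈ H.mumfordTateGroup, ∀ w ∈ W, tensorSpaceAct g w ∈ W)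
    {s : hodgeTensorSpaceOver ℂ (ℂ ⊗[ℚ] V) a b} (hs : s ∈ subspaceBaseChange V W) :
    tensorDerivation a b (gradingEnd e deg) s ∈ subspaceBaseChange V W :=
  subspaceBaseChange_gradingEnd_stable H e hF hFc W
    (fun _ hX _ hw => tensorDerivation_apply_mem_of_mumfordTateGroup_stable H W hW hX hw) hs

end HodgeStructure

end Literature.AlgebraicGeometry.Motives

end
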